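/-
Origin: expansion seat `prover-pub-hodgecm-mc-carch-1-g5-0`, handover #CA53 2026-08-20T12:03:16Z md5 eeecb1ef70fd (171 l., 9 decls; NEW additive leaf; imports RUN-50 #CA50 #CA52 + sinst #1226 Model.ArchConjSlotVT + period #P50c Model.ArchConjSlotVTGeneric; RUN 51; drops ⇒ {#CA55, #CA57}; cert certs/ax-ArchKTypeOfSigmaConjHolds-eeecb1ef70fd.log: rc 0 / 67 s / 0 warnings / trio) (`HOME/mc/pub-hodgecm-mc-carch-1/pkg51/HodgeCM/Model/ArchKTypeOfSigmaConjHolds.lean`, md5 eeecb1ef70fd, 171 lines);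
landed by the gen-20 packager (p-g20) in gate run 51 as `HodgeCM/Model/ArchKTypeOfSigmaConjHolds.lean` (verbatim).
-/
/-
Copyright (c) 2026. Released under Apache 2.0 license as described in the file LICENSE.
Cell pub-hodgecm, MODEL layer (construction prover mc-carch-1, gen 5), BINDER-OWNERS rows 12 / 17–19, junction (C-Σ)′ DISCHARGED:
the R1/R2 consistency of the shared V-character — `nVR = nVR₂` off `v₁` and `nVR (mk ι₁) = −eP² − eP³ − ℓ″` — HYPOTHESIS-FREE, by feeding
period-1's letter-generic (STRIP) ∧ (VT) (#P50c) and sinst-1's `hSV_holds` (#1226) into #CA50 / #CA52.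
-/
import Summits.HodgeConjecture.HodgeCM.Model.ArchKTypeOfSigmaConj
import Summits.HodgeConjecture.HodgeCM.Model.ArchKTypeOfSigmaIotaConj
import Summits.HodgeConjecture.HodgeCM.Model.ArchConjSlotVTGeneric
import Summits.HodgeConjecture.HodgeCM.Model.ArchConjSlotVT

/-!
# (C-Σ)′ DISCHARGED: the conjugated see-saw consistency at every place, hypothesis-free

#CA50 (`…_of_strip_vt`, off `v₁`) and #CA52 (`…_of_strip_vt`, at `v₁`) took theta-3 (K10)'s (STRIP) ∧ (VT) texts as hypotheses (`hSV`, resp. the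
vacuum companion `hSV₁`).  RUN 50 makes both THEOREMS: period-1 #P50c `ArchConjSlotVTGeneric.exists_smul_forall_strip_vt` (ONE scalar for all slot
data; from #P48a [Weil1964 n°37; MVW 1987 ch. 2 §II] + sinst-1 #1223–#1225 [Folland1989 (1.43), (1.50)]) with its two instances
`forall_strip_vt_linePhi_of` / `forall_strip_vt_vacuum_of`, and sinst-1 #1226 `ArchConjSlotVT.hSV_holds` (= (K10)'s `hSV` verbatim).  Hence:

* § 1 per context: **`pairVacExponent_eq_conj (hb)`**, **`nVR_eq_nVR₂ (hb)`** (`b ≠ v₁`), **`lambdaExponentConj_add_eq (hemb)`**,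
  **`nVR_mk_eq_conj (hemb)`**, **`nVR_sub_n₃R_mk (hemb)`** — the (c5)₂ / (χ)₂ TYPE conditions of #CA48 `hdef_two_of_archType` / #CA51
  `hχ_two_of_archType` at pin R2 with the SHARED `χV := χVR` and `ν′` of type `n₃R`;
* § 2 guarded families (E's binder style, OG guard): **`SInstance.nVR_eq_nVR₂_of_GOG_holds`**, **`SInstance.pairVacExponent_eq_conj_of_GOG_holds`**
  (#CA50 § 4 at `hSV_holds hGR`), **`SInstance.lambdaExponentConj_add_eq_of_GOG`**, **`SInstance.nVR_mk_eq_conj_of_GOG`** (`hemb := hG.1`).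

So lines 0/1 (pin R1) and lines 2/3 (pin R2) provably carry ONE V-character `χVR` — the design requirement of the R2 pin holds in the kernel.
0 records, 0 `def … : Prop`, nothing cited as a hypothesis, no hypothesis beyond E's splitting families and the OG guard.
-/

set_option autoImplicit false

noncomputable section

open NumberField NumberField.InfinitePlace NumberField.mixedEmbedding IsDedekindDomain
open scoped Matrix Classical TensorProduct SchwartzMap
open Literature.NumberTheory.Automorphic Literature.NumberTheory.Automorphic.UnitaryGroup Literature.NumberTheory.Weil1964
open Literature.NumberTheory.GelbartRogawski1991 Literature.NumberTheory.GelbartRogawski1991.UnitaryDualPair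
open Literature.RepresentationTheory.KonnoKonno2007
open Literature.Analysis.SegalBargmann
open HodgeCM.Adelic HodgeCM.PerL34 HodgeCM.Model.HypCensus HodgeCM.Model.ArchSideTerm HodgeCM.Model.SupplyInstance

namespace HodgeCM.Model

section Holds

variable {L : CMField} {ι₁ : L →+* ℂ} (V : HermSpace3 L ι₁) (c : SeesawCtx L)
variable
  (hGR : (cmSplittingDatum (L : Type) finProdFinEquiv (frameD V) (frameD_real V) (frameD_ne V) (dW c.D) (dW_real c.D) (dW_ne c.D)).CompatibleSplitting)
  (hGR₀ : (cmSplittingDatum (L : Type) (e₁) (frameD V) (frameD_real V) (frameD_ne V) (lineVec (L : Type) (dW c.D 0))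
    (fun _ => dW_real c.D 0) (fun _ => dW_ne c.D 0)).CompatibleSplitting)
  (hGR₁ : (cmSplittingDatum (L : Type) (e₁) (frameD V) (frameD_real V) (frameD_ne V) (lineVec (L : Type) (dW c.D 1))
    (fun _ => dW_real c.D 1) (fun _ => dW_ne c.D 1)).CompatibleSplitting)
  (hGR₂ : (cmSplittingDatum (L : Type) (e₁) (frameD V) (frameD_real V) (frameD_ne V) (lineVec (L : Type) (dW' c.D 0))
    (fun _ => dW'_real c.D 0) (fun _ => dW'_ne c.D 0)).CompatibleSplitting)
  (hGR₃ : (cmSplittingDatum (L : Type) (e₁) (frameD V) (frameD_real V) (frameD_ne V) (lineVec (L : Type) (dW' c.D 1))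
    (fun _ => dW'_real c.D 1) (fun _ => dW'_ne c.D 1)).CompatibleSplitting)
  (h₁W : (∀ j, 0 < (ι₁ (dW c.D j)).re) ∨ ∀ j, (ι₁ (dW c.D j)).re < 0)
  (hpos₀ : 0 < cmXW (L : Type) (frameD V) (lineVec (L : Type) (dW c.D 0)) (fun _ => dW_real c.D 0) ι₁ (HypCensus.cmPlace (L : Type) ι₁) 0)
  (hpos₁ : 0 < cmXW (L : Type) (frameD V) (lineVec (L : Type) (dW c.D 1)) (fun _ => dW_real c.D 1) ι₁ (HypCensus.cmPlace (L : Type) ι₁) 0)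
  (hpos₂ : 0 < cmXW (L : Type) (frameD V) (lineVec (L : Type) (dW' c.D 0)) (fun _ => dW'_real c.D 0) ι₁ (HypCensus.cmPlace (L : Type) ι₁) 0)
  (hpos₃ : 0 < cmXW (L : Type) (frameD V) (lineVec (L : Type) (dW' c.D 1)) (fun _ => dW'_real c.D 1) ι₁ (HypCensus.cmPlace (L : Type) ι₁) 0)

/-! ## § 1 Per context -/

include hpos₀ hpos₁ in
/-- **(C-Σ)′ off `v₁`, HYPOTHESIS-FREE**: `pairVacExponent b = a₂ b + a₃ b + ℓ′_b` (`b ≠ v₁`). -/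
theorem pairVacExponent_eq_conj {b : {v : InfinitePlace ↥(maximalRealSubfield L) // v.IsReal}} (hb : b ≠ HypCensus.cmPlace (L : Type) ι₁) :
    pairVacExponent V c.D hGR h₁W b =
      defExponentTwo V c hGR₂ hpos₂ b + defExponentThree V c hGR₃ hpos₃ b + defLambdaExponentConj V c.D hGR hGR₂ hGR₃ h₁W b hb := by
  obtain ⟨a, h⟩ := exists_smul_forall_strip_vt V c.D hGR
  obtain ⟨Y, F, hstrip, hY⟩ := forall_strip_vt_linePhi_of V c.D hGR hpos₀ hpos₁ hpos₂ hpos₃ a h 1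
  exact pairVacExponent_eq_conj_of_strip_vt V c hGR hGR₂ hGR₃ h₁W hpos₀ hpos₁ hpos₂ hpos₃ Y F hstrip a hY hb

/-- **THE R1/R2 CONSISTENCY off `v₁`, HYPOTHESIS-FREE**: `nVR (w b) = nVR₂ (w b)`. -/
theorem nVR_eq_nVR₂ {b : {v : InfinitePlace ↥(maximalRealSubfield L) // v.IsReal}} (hb : b ≠ HypCensus.cmPlace (L : Type) ι₁) :
    nVR V c hGR hGR₀ hGR₁ h₁W hpos₀ hpos₁ (cmPlaceOver (L : Type) b).1 = nVR₂ V c hGR hGR₂ hGR₃ h₁W hpos₂ hpos₃ (cmPlaceOver (L : Type) b).1 := by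
  obtain ⟨a, h⟩ := exists_smul_forall_strip_vt V c.D hGR
  obtain ⟨Y, F, hstrip, hY⟩ := forall_strip_vt_linePhi_of V c.D hGR hpos₀ hpos₁ hpos₂ hpos₃ a h 1
  exact nVR_eq_nVR₂_of_strip_vt V c hGR hGR₀ hGR₁ hGR₂ hGR₃ h₁W hpos₀ hpos₁ hpos₂ hpos₃ Y F hstrip a hY hb

variable (hemb : (InfinitePlace.mk ι₁).embedding = ι₁)

include hemb in
/-- **(C-Σ)′ AT `v₁`, HYPOTHESIS-FREE (under E's guard)**: `lambdaExponentConj + eP² + eP³ = lambdaExponent + eP⁰ + eP¹`. -/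
theorem lambdaExponentConj_add_eq :
    lambdaExponentConj V c.D hGR hGR₂ hGR₃ h₁W + (lineVacExponentsTwo V c hGR₂ (posIdxEquivUnit hpos₂) (negIdxEquivEmpty hpos₂)).eP + (lineVacExponentsThree V c hGR₃ (posIdxEquivUnit hpos₃) (negIdxEquivEmpty hpos₃)).eP =
      lambdaExponent V c.D hGR hGR₀ hGR₁ h₁W + (lineVacExponentsZero V c hGR₀ h₁W (posIdxEquivUnit hpos₀) (negIdxEquivEmpty hpos₀)).eP + (lineVacExponentsOne V c hGR₁ h₁W (posIdxEquivUnit hpos₁) (negIdxEquivEmpty hpos₁)).eP := by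
  obtain ⟨a, h⟩ := exists_smul_forall_strip_vt V c.D hGR
  exact lambdaExponentConj_add_eq_of_strip_vt V c hGR hGR₀ hGR₁ hGR₂ hGR₃ h₁W hpos₀ hpos₁ hpos₂ hpos₃ hemb fun x₂ x₃ => by
    obtain ⟨Y, F, hstrip, hY⟩ := forall_strip_vt_vacuum_of V c.D hGR a h x₂ x₃ 1
    exact ⟨Y, F, a, hstrip, hY⟩

include hemb in
/-- **the R2 value at the place of `ι₁`, HYPOTHESIS-FREE**: `nVR (mk ι₁) = −eP² − eP³ − ℓ″`. -/
theorem nVR_mk_eq_conj :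
    nVR V c hGR hGR₀ hGR₁ h₁W hpos₀ hpos₁ (InfinitePlace.mk ι₁) =
      -(lineVacExponentsTwo V c hGR₂ (posIdxEquivUnit hpos₂) (negIdxEquivEmpty hpos₂)).eP - (lineVacExponentsThree V c hGR₃ (posIdxEquivUnit hpos₃) (negIdxEquivEmpty hpos₃)).eP - lambdaExponentConj V c.D hGR hGR₂ hGR₃ h₁W := by
  have h := lambdaExponentConj_add_eq V c hGR hGR₀ hGR₁ hGR₂ hGR₃ h₁W hpos₀ hpos₁ hpos₂ hpos₃ hemb
  rw [nVR_mk]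
  omega

include hemb in
/-- socket form: `(nVR (mk ι₁) − n₃R (mk ι₁)) + ℓ″ + eP² = 0` — the `hm` of #CA51 `hχ_two_of_archType` at pin R2, HYPOTHESIS-FREE. -/
theorem nVR_sub_n₃R_mk :
    nVR V c hGR hGR₀ hGR₁ h₁W hpos₀ hpos₁ (InfinitePlace.mk ι₁) - n₃R V c hGR₃ hpos₃ (InfinitePlace.mk ι₁) +
        lambdaExponentConj V c.D hGR hGR₂ hGR₃ h₁W + (lineVacExponentsTwo V c hGR₂ (posIdxEquivUnit hpos₂) (negIdxEquivEmpty hpos₂)).eP = 0 := by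
  rw [nVR_mk_eq_conj V c hGR hGR₀ hGR₁ hGR₂ hGR₃ h₁W hpos₀ hpos₁ hpos₂ hpos₃ hemb, n₃R_mk]
  ring

end Holds

end HodgeCM.Model

/-! ## § 2 Guarded families -/

namespace HodgeCM.Model.SInstance

open HodgeCM.Model HodgeCM.Model.ArchSideTerm

variable
  (hGR : ∀ {L : CMField} {ι₁ : L →+* ℂ} (V : HermSpace3 L ι₁) (c : SeesawCtx L),
    (cmSplittingDatum (L : Type) finProdFinEquiv (frameD V) (frameD_real V) (frameD_ne V) (dW c.D) (dW_real c.D)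
      (dW_ne c.D)).CompatibleSplitting)
  (hGR₀ : ∀ {L : CMField} {ι₁ : L →+* ℂ} (V : HermSpace3 L ι₁) (c : SeesawCtx L),
    (cmSplittingDatum (L : Type) (ArchSideTerm.e₁) (frameD V) (frameD_real V) (frameD_ne V) (lineVec (L : Type) (dW c.D 0))
      (fun _ => dW_real c.D 0) (fun _ => dW_ne c.D 0)).CompatibleSplitting)
  (hGR₁ : ∀ {L : CMField} {ι₁ : L →+* ℂ} (V : HermSpace3 L ι₁) (c : SeesawCtx L),
    (cmSplittingDatum (L : Type) (ArchSideTerm.e₁) (frameD V) (frameD_real V) (frameD_ne V) (lineVec (L : Type) (dW c.D 1))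
      (fun _ => dW_real c.D 1) (fun _ => dW_ne c.D 1)).CompatibleSplitting)
  (hGR₂ : ∀ {L : CMField} {ι₁ : L →+* ℂ} (V : HermSpace3 L ι₁) (c : SeesawCtx L),
    (cmSplittingDatum (L : Type) (ArchSideTerm.e₁) (frameD V) (frameD_real V) (frameD_ne V) (lineVec (L : Type) (dW' c.D 0))
      (fun _ => dW'_real c.D 0) (fun _ => dW'_ne c.D 0)).CompatibleSplitting)
  (hGR₃ : ∀ {L : CMField} {ι₁ : L →+* ℂ} (V : HermSpace3 L ι₁) (c : SeesawCtx L),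
    (cmSplittingDatum (L : Type) (ArchSideTerm.e₁) (frameD V) (frameD_real V) (frameD_ne V) (lineVec (L : Type) (dW' c.D 1))
      (fun _ => dW'_real c.D 1) (fun _ => dW'_ne c.D 1)).CompatibleSplitting)

/-- **(C-Σ)′ UNDER THE OG GUARD, HYPOTHESIS-FREE**: `pairVacExponent b = a₂ b + a₃ b + ℓ′_b` for every `b ≠ v₁` (#CA50 § 4 at sinst-1's `hSV_holds`). -/
theorem pairVacExponent_eq_conj_of_GOG_holds {L : CMField} {ι₁ : L →+* ℂ} (V : HermSpace3 L ι₁) (c : SeesawCtx L) (hG : GOG V c)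
    {b : {v : InfinitePlace ↥(maximalRealSubfield L) // v.IsReal}} (hb : b ≠ HypCensus.cmPlace (L : Type) ι₁) :
    pairVacExponent V c.D (hGR V c) (hG_GOG V c hG) b =
      defExponentTwo V c (hGR₂ V c) (hpos_GOG V c hG).2.2.1 b + defExponentThree V c (hGR₃ V c) (hpos_GOG V c hG).2.2.2 b +
        defLambdaExponentConj V c.D (hGR V c) (hGR₂ V c) (hGR₃ V c) (hG_GOG V c hG) b hb :=
  pairVacExponent_eq_conj_of_GOG hGR hGR₂ hGR₃ (hSV_holds hGR) V c hG hb

/-- **THE R1/R2 CONSISTENCY off `v₁` UNDER THE OG GUARD, HYPOTHESIS-FREE**: `nVR (w b) = nVR₂ (w b)`, `b ≠ v₁`. -/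
theorem nVR_eq_nVR₂_of_GOG_holds {L : CMField} {ι₁ : L →+* ℂ} (V : HermSpace3 L ι₁) (c : SeesawCtx L) (hG : GOG V c)
    {b : {v : InfinitePlace ↥(maximalRealSubfield L) // v.IsReal}} (hb : b ≠ HypCensus.cmPlace (L : Type) ι₁) :
    nVR V c (hGR V c) (hGR₀ V c) (hGR₁ V c) (hG_GOG V c hG) (hpos_GOG V c hG).1 (hpos_GOG V c hG).2.1 (cmPlaceOver (L : Type) b).1 =
      nVR₂ V c (hGR V c) (hGR₂ V c) (hGR₃ V c) (hG_GOG V c hG) (hpos_GOG V c hG).2.2.1 (hpos_GOG V c hG).2.2.2 (cmPlaceOver (L : Type) b).1 :=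
  nVR_eq_nVR₂_of_GOG hGR hGR₀ hGR₁ hGR₂ hGR₃ (hSV_holds hGR) V c hG hb

/-- **(C-Σ)′ AT `v₁` UNDER THE OG GUARD, HYPOTHESIS-FREE**: `lambdaExponentConj + eP² + eP³ = lambdaExponent + eP⁰ + eP¹` (`hemb := hG.1`). -/
theorem lambdaExponentConj_add_eq_of_GOG {L : CMField} {ι₁ : L →+* ℂ} (V : HermSpace3 L ι₁) (c : SeesawCtx L) (hG : GOG V c) :
    lambdaExponentConj V c.D (hGR V c) (hGR₂ V c) (hGR₃ V c) (hG_GOG V c hG) +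
          (lineVacExponentsTwo V c (hGR₂ V c) (posIdxEquivUnit (hpos_GOG V c hG).2.2.1) (negIdxEquivEmpty (hpos_GOG V c hG).2.2.1)).eP + (lineVacExponentsThree V c (hGR₃ V c) (posIdxEquivUnit (hpos_GOG V c hG).2.2.2) (negIdxEquivEmpty (hpos_GOG V c hG).2.2.2)).eP =
      lambdaExponent V c.D (hGR V c) (hGR₀ V c) (hGR₁ V c) (hG_GOG V c hG) +
          (lineVacExponentsZero V c (hGR₀ V c) (hG_GOG V c hG) (posIdxEquivUnit (hpos_GOG V c hG).1) (negIdxEquivEmpty (hpos_GOG V c hG).1)).eP + (lineVacExponentsOne V c (hGR₁ V c) (hG_GOG V c hG) (posIdxEquivUnit (hpos_GOG V c hG).2.1) (negIdxEquivEmpty (hpos_GOG V c hG).2.1)).eP :=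
  lambdaExponentConj_add_eq V c (hGR V c) (hGR₀ V c) (hGR₁ V c) (hGR₂ V c) (hGR₃ V c) (hG_GOG V c hG) (hpos_GOG V c hG).1 (hpos_GOG V c hG).2.1
    (hpos_GOG V c hG).2.2.1 (hpos_GOG V c hG).2.2.2 hG.1

/-- **the R2 value at `w(ι₁)` UNDER THE OG GUARD, HYPOTHESIS-FREE**: `nVR (mk ι₁) = −eP² − eP³ − ℓ″`. -/
theorem nVR_mk_eq_conj_of_GOG {L : CMField} {ι₁ : L →+* ℂ} (V : HermSpace3 L ι₁) (c : SeesawCtx L) (hG : GOG V c) :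
    nVR V c (hGR V c) (hGR₀ V c) (hGR₁ V c) (hG_GOG V c hG) (hpos_GOG V c hG).1 (hpos_GOG V c hG).2.1 (InfinitePlace.mk ι₁) =
      -(lineVacExponentsTwo V c (hGR₂ V c) (posIdxEquivUnit (hpos_GOG V c hG).2.2.1) (negIdxEquivEmpty (hpos_GOG V c hG).2.2.1)).eP - (lineVacExponentsThree V c (hGR₃ V c) (posIdxEquivUnit (hpos_GOG V c hG).2.2.2) (negIdxEquivEmpty (hpos_GOG V c hG).2.2.2)).eP -
        lambdaExponentConj V c.D (hGR V c) (hGR₂ V c) (hGR₃ V c) (hG_GOG V c hG) :=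
  nVR_mk_eq_conj V c (hGR V c) (hGR₀ V c) (hGR₁ V c) (hGR₂ V c) (hGR₃ V c) (hG_GOG V c hG) (hpos_GOG V c hG).1 (hpos_GOG V c hG).2.1
    (hpos_GOG V c hG).2.2.1 (hpos_GOG V c hG).2.2.2 hG.1

end HodgeCM.Model.SInstance

end
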